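import Literature.MathematicalPhysics.QuantumLattice.KomaTasakiSSBOverlap
import Literature.MathematicalPhysics.QuantumLattice.HubbardTorusCharges
import Literature.MathematicalPhysics.QuantumLattice.PairFieldMomentum
import Literature.MathematicalPhysics.QuantumLattice.DWaveSourceProofs
import Literature.MathematicalPhysics.QuantumLattice.HubbardModelGrandCanonicalProofs
import Literature.MathematicalPhysics.QuantumLattice.FinDimSpectrumProofs
import HarnessLib

/-!
# The grand-canonical Hubbard torus with a bond pair field IS a Koma–Tasaki `U(1)` system with
# bounded-overlap order densities (KT94 §3.3–3.4 / KT93 §7: "electron pair condensation problems")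

T. Koma, H. Tasaki, *Symmetry breaking and finite-size effects in quantum many-body systems*,
J. Stat. Phys. **76** (1994) 745–803 (`KomaTasaki1994`), §3.3 "Hubbard model" and §3.4: for lattice
electrons with Hamiltonian `H_Λ = Σ_x h_x` the `U(1)` generator is (half) the electron number,
`C_Λ = N_e/2` up to a constant, and the superconducting order operators are built from pair fields,
`o^{(1)}_x = P_x + P_x†`, `o^{(2)}_x = i(P_x - P_x†)` (so that `O^+ = O^{(1)} + iO^{(2)} = 2 Σ_x P_x†`
raises `C` by one); "We can then follow the general discussions in Section 2" — i.e. hypotheses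
(2.12)–(2.16), ii), iii) hold, and i) holds in the BOUNDED-OVERLAP form i′) of
`KomaTasakiSSBOverlap.lean` (pair fields on overlapping plaquettes do not commute; KT94 §3.4 "with
some extra care"; KT93, CMP 158 (1993) p. 211: Theorem 7.3 "allows one to apply the theorem to …
the electron pair condensation problems in lattice electron systems").

## What this file constructs and proves (sorry-free)

For the torus `(ℤ/Lℤ)²`, hopping `t`, coupling `U`, chemical potential `μ` and ANY pair form factor
`g : Site 2 → ℝ` on `{0, ±e₁, ±e₂}` with `Σ_e |g e/√2| > 0` (`d`-wave: `dWaveFormFactor`):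

* `DWaveKT.plaq L y` — the 5-site plaquette `{y + e}` of the local pair `P_y = localPair g L y`;
  `DWaveKT.overlapSet L y = {y' : plaq y ∩ plaq y' ≠ ∅}`, `|overlapSet| ≤ 25`
  (`card_overlapSet_le`);
* `DWaveKT.localHam L t U μ y` — the Hubbard terms (`hubbardTermOp`: symmetrised hoppings on ordered
  bonds, on-site `U n↑n↓ - μ n`) ANCHORED at `y`; `Σ_y localHam y = hubbardTorusWith 2 L t U μ`
  (`sum_localHam`), Hermitian, even and localised on `plaq y`, `‖localHam y‖ ≤ 45(2|t|+|U|+2|μ|)`;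
* `DWaveKT.pairDensity g L α y` — `o^{(1)}_y = P_y + P_y†`, `o^{(2)}_y = i(P_y - P_y†)`: Hermitian, even,
  localised on `plaq y`, `‖·‖ ≤ 2K_g`, `K_g = 2Σ_e|g e/√2|`; `Σ_y o^{(1)}_y = Δ_g + Δ_g†`,
  `Σ_y o^{(2)}_y = i(Δ_g - Δ_g†)` (`Δ_g = pairField g L`);
* **`dWaveKTSystem L t U μ g hg : KomaTasaki.U1OverlapSystem (TorusSite 2 L) (EuclideanSpace ℂ _)`** —
  the data above transported along `Matrix.toEuclideanCLM`, with `C = N/2`, `S_x = T_x = overlapSet x`,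
  `r = r′ = 25`, `h̄ = 45(2|t|+|U|+2|μ|)`, `o = 2K_g`; ALL structure fields PROVED: (2.12)
  `[H, N/2] = 0`, (2.14) `[Δ+Δ†, N/2] = -i·i(Δ-Δ†)`, `[i(Δ-Δ†), N/2] = i(Δ+Δ†)` (from `[N, P_y] = -2P_y`),
  i′)/ii) by graded locality of even operators on disjoint plaquettes (`commute_of_mem_carEvenSubalgebra`),
  iii) by the norm counts;
* dictionary: `dWaveKTSystem_hamiltonian` (`H_sys = toEuclideanCLM (hubbardTorusWith 2 L t U μ)`),
  `dWaveKTSystem_order_zero/one`, `dWaveKTSystem_C`, `dWaveKTSystem_field`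
  (`H_sys - (B:ℂ)•O^{(1)}_sys = toEuclideanCLM (hubbardTorusWith - B(Δ+Δ†))`, at `t = 1`, `g = d` this is
  `dWaveSourceTorus L U μ B`), `card_torusSite : N = L²`;
* `KomaTasaki.U1System.inner_order_sq_eq_of_eigen_C` — for ANY `U1System` and any `C`-eigenvector `Φ`,
  `⟨Φ,(O^{(1)})²Φ⟩ = ⟨Φ,(O^{(2)})²Φ⟩` (charge bookkeeping: `⟨Φ,(O^+)²Φ⟩ = 0`), so the second half of
  hypothesis iv) (2.17) is automatic;
* `dWaveKTSystem_isLROEigenstate` — hypothesis iv) for the instance from matrix data: a unit Fock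
  vector `Φ` with `(H - μN)Φ = EΦ`, `NΦ = nΦ` and pair long-range order
  `(μ′ · 2K_g · L²)² ≤ Re Φ†(Δ+Δ†)²Φ` is an `IsLROEigenstate` of `dWaveKTSystem` with parameter `μ′`.

With this instance every abstract Koma–Tasaki theorem of the tree applies to the `d`-wave pair field
of the Hubbard model BY NAME: KT94 Thm 2.5 (2.30) (`U1OverlapSystem.theorem_2_5_orderOne_fin`,
landed) and KT93 Thm 7.3 (`U1OverlapSystem.field_order_ge_xiState_of_card_ge`,
`komaTasakiU1Field_holds`, companion file `KomaTasakiU1FieldBound.lean`) — the latter turns a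
certified sourced one-point value of `dWaveSourceTorus` into a CEILING `σ ≤ m(B)/√2` on pair LRO.
(Cell `pub/hubbard-cq`, START-HERE §4 row p4.)

## Mathlib / tree search

Reused (not restated): `hubbardTermOp`, `hubbardTermSupp`, `sum_hubbardTermOp`,
`hubbardTermOp_mem_carEvenSubalgebra`, `isHermitian_hubbardTermOp`, `norm_hubbardTermOp_le`,
`card_filter_not_disjoint_hubbardTermSupp_le`, `isHermitian_finset_sum` (`FermionLiebRobinson`),
`card_filter_fermionTorusGraph_adj_le` (`HubbardLSMFillingProofs`), `commute_of_mem_carEvenSubalgebra`,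
`carEvenSubalgebra_mono`, `carEvenSubalgebra_le_carSubalgebra` (`FermionTraceFactorization`),
`localPair`, `pairField`, `localPair_eq_sum_bondPair`, `bondPair_conjTranspose`, `norm_localPair_le`,
`totalNumber_commutator_localPair`, `totalNumber_isHermitian`, `hamiltonianWith_commute_totalNumber`,
`Matrix.isSelfAdjoint_toEuclideanCLM_iff`; Mathlib `Matrix.toEuclideanCLM` (star-algebra equivalence,
`Matrix.l2_opNorm_toEuclideanCLM`), `Finset.sum_fiberwise`.
-/

noncomputable section

open Matrix Complex Finset WithLp Literature.Probability.LatticeModels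
open Literature.Barriers.HubbardSuperconductivity
open scoped Matrix.Norms.L2Operator InnerProductSpace ComplexConjugate ComplexOrder

namespace Literature.MathematicalPhysics.QuantumLattice

/-- ONE `DecidableEq (FermionTorus 2 L)` instance for the whole file: the generic CAR-algebra lemmas carry
`LinearOrder.toDecidableEq`, instance resolution on the concrete torus would find the computable
`instDecidableEqLex` (cf. `DWaveSourceNNNHopping`), and two names for the same instance make the kernel
unfold `Matrix.toEuclideanCLM` when checking the dictionary lemmas below. [folklore] -/
local instance (priority := high) instDecidableEqFermionTorusKT {L : ℕ} :
    DecidableEq (FermionTorus 2 L) :=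
  LinearOrder.toDecidableEq

/-! ### Charge bookkeeping: the two LRO parameters of a `C`-eigenvector coincide -/

namespace KomaTasaki.U1System

variable {Λ : Type*} [Fintype Λ] {E : Type*} [NormedAddCommGroup E] [InnerProductSpace ℂ E]
  (sys : KomaTasaki.U1System Λ E)

/-- **The second half of hypothesis iv) (2.17) is automatic**: for a `C`-eigenvector `Φ`,
`⟨Φ,(O^{(1)})²Φ⟩ = ⟨Φ,(O^{(2)})²Φ⟩`.  Indeed `(O^+)²` raises the charge by `2`, so
`⟨Φ,(O^+)²Φ⟩ = 0` (KT94 (2.16), (2.18)), and `(O^+)² = (O^{(1)})² - (O^{(2)})² + i{O^{(1)},O^{(2)}}` with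
all three expectations real. [cite: KomaTasaki1994, (2.16)–(2.18)] -/
theorem inner_order_sq_eq_of_eigen_C {Φ : E} {c : ℂ} (hC : sys.C Φ = c • Φ) :
    ⟪Φ, sys.order 0 (sys.order 0 Φ)⟫_ℂ = ⟪Φ, sys.order 1 (sys.order 1 Φ)⟫_ℂ := by
  by_cases hΦ : Φ = 0
  · simp [hΦ]
  have hc : conj c = c := sys.conj_eq_of_eigen_C hΦ hC
  -- `⟨Φ, O⁺ O⁺ Φ⟩ = 0` by charge
  have h2 : sys.C (sys.orderPlus (sys.orderPlus Φ)) = (c + 1 + 1) • sys.orderPlus (sys.orderPlus Φ) :=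
    sys.C_orderPlus_apply (sys.C_orderPlus_apply hC)
  have hzero : ⟪Φ, sys.orderPlus (sys.orderPlus Φ)⟫_ℂ = 0 := by
    refine sys.inner_eq_zero_of_eigen_C hC h2 ?_
    rw [hc]
    intro h
    have := congrArg Complex.re h
    simp only [Complex.add_re, Complex.one_re] at this
    linarith
  -- symmetry of `O^{(α)}`
  have hs : ∀ (α : Fin 2) (x y : E), ⟪sys.order α x, y⟫_ℂ = ⟪x, sys.order α y⟫_ℂ :=
    fun α x y => sys.isSymmetric_order α x y
  -- the three real numbers
  set a : ℂ := ⟪Φ, sys.order 0 (sys.order 0 Φ)⟫_ℂ with ha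
  set b : ℂ := ⟪Φ, sys.order 1 (sys.order 1 Φ)⟫_ℂ with hb
  set s : ℂ := ⟪Φ, sys.order 0 (sys.order 1 Φ)⟫_ℂ + ⟪Φ, sys.order 1 (sys.order 0 Φ)⟫_ℂ with hsd
  have ha_real : conj a = a := by
    rw [ha, ← hs, inner_conj_symm, ← hs]
  have hb_real : conj b = b := by
    rw [hb, ← hs, inner_conj_symm, ← hs]
  have hs_real : conj s = s := by
    rw [hsd, map_add, ← hs 0, inner_conj_symm, ← hs 1, inner_conj_symm, hs 1, hs 0, add_comm]
  -- expand `O⁺O⁺`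
  have hexp : ⟪Φ, sys.orderPlus (sys.orderPlus Φ)⟫_ℂ = a - b + I * s := by
    have e1 : sys.orderPlus (sys.orderPlus Φ) =
        sys.order 0 (sys.order 0 Φ) + I • sys.order 0 (sys.order 1 Φ)
          + (I • sys.order 1 (sys.order 0 Φ) + (I * I) • sys.order 1 (sys.order 1 Φ)) := by
      simp only [KomaTasaki.U1System.orderPlus, _root_.add_apply, _root_.smul_apply, map_add,
        map_smul]
      module
    rw [e1, inner_add_right, inner_add_right, inner_add_right, inner_smul_right, inner_smul_right,
      inner_smul_right, Complex.I_mul_I, ← ha, ← hb, hsd]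
    ring
  rw [hexp] at hzero
  -- real parts
  have hre := congrArg Complex.re hzero
  have ha_im : a.im = 0 := Complex.conj_eq_iff_im.mp ha_real
  have hb_im : b.im = 0 := Complex.conj_eq_iff_im.mp hb_real
  have hs_im : s.im = 0 := Complex.conj_eq_iff_im.mp hs_real
  simp only [Complex.add_re, Complex.sub_re, Complex.mul_re, Complex.I_re, Complex.I_im, hs_im,
    zero_mul, one_mul, sub_zero, Complex.zero_re] at hre
  apply Complex.ext
  · linarith
  · rw [ha_im, hb_im]

end KomaTasaki.U1System

/-! ### Geometry of the 5-site plaquettes on the torus -/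

namespace DWaveKT

variable (L : ℕ) [NeZero L]

/-- The plaquette `{y + e : e ∈ {0, ±e₁, ±e₂}}` carrying the local pair `P_y` (and every Hubbard term
anchored at `y`), as a set of fermionic-torus sites. [cite: KomaTasaki1994, §3.3] -/
def plaq (y : TorusSite 2 L) : Finset (FermionTorus 2 L) :=
  (insert (0 : Site 2) unitSteps).image fun e => FermionTorus.ofTorusSite (y + Torus.proj L e)

/-- `|{0, ±e₁, ±e₂}| ≤ 5`. [folklore] -/
private theorem card_steps_le : (insert (0 : Site 2) unitSteps).card ≤ 5 := by
  refine (Finset.card_insert_le _ _).trans ?_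
  have : unitSteps.card ≤ 4 := by
    unfold unitSteps
    refine (Finset.card_insert_le _ _).trans ?_
    refine Nat.succ_le_succ ((Finset.card_insert_le _ _).trans ?_)
    refine Nat.succ_le_succ ((Finset.card_insert_le _ _).trans ?_)
    simp
  omega

/-- `|plaq y| ≤ 5`. [folklore] -/
private theorem card_plaq_le (y : TorusSite 2 L) : (plaq L y).card ≤ 5 :=
  Finset.card_image_le.trans (card_steps_le)

/-- `y + e ∈ plaq y`. [folklore] -/
private theorem add_mem_plaq (y : TorusSite 2 L) {e : Site 2} (he : e ∈ insert (0 : Site 2) unitSteps) :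
    FermionTorus.ofTorusSite (y + Torus.proj L e) ∈ plaq L y :=
  Finset.mem_image_of_mem _ he

omit [NeZero L] in
/-- `Torus.proj L 0 = 0`. [folklore] -/
private theorem proj_zero : Torus.proj L (0 : Site 2) = 0 := by
  funext i; simp

/-- `y ∈ plaq y`. [folklore] -/
private theorem self_mem_plaq (y : TorusSite 2 L) : FermionTorus.ofTorusSite y ∈ plaq L y := by
  have h := add_mem_plaq L y (Finset.mem_insert_self (0 : Site 2) unitSteps)
  rwa [proj_zero, add_zero] at h

/-- The sites whose plaquettes meet the plaquette of `y` (hypotheses i′) and ii): densities /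
Hamiltonian terms at `y` commute with densities at every other site). [cite: KomaTasaki1994, §2.3 i) ii), §3.4] -/
def overlapSet (y : TorusSite 2 L) : Finset (TorusSite 2 L) :=
  Finset.univ.filter fun y' => ¬ Disjoint (plaq L y) (plaq L y')

/-- Outside the overlap set the plaquettes are disjoint. [folklore] -/
private theorem disjoint_plaq_of_not_mem {y y' : TorusSite 2 L} (h : y' ∉ overlapSet L y) :
    Disjoint (plaq L y) (plaq L y') := by
  simpa [overlapSet] using h

/-- `|overlapSet y| ≤ 25` (a meeting point `y + e = y' + e'` determines `y' = y + e - e'`).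
[cite: KomaTasaki1994, §2.3 i) ii)] -/
theorem card_overlapSet_le (y : TorusSite 2 L) : (overlapSet L y).card ≤ 25 := by
  classical
  set S : Finset (Site 2) := insert 0 unitSteps with hS
  have hsub : overlapSet L y ⊆ (S ×ˢ S).image fun p => y + Torus.proj L p.1 - Torus.proj L p.2 := by
    intro y' hy'
    rw [overlapSet, Finset.mem_filter, Finset.not_disjoint_iff] at hy'
    obtain ⟨z, hz, hz'⟩ := hy'.2
    rw [plaq, Finset.mem_image] at hz hz'
    obtain ⟨e, he, rfl⟩ := hz
    obtain ⟨e', he', heq⟩ := hz'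
    have hinj := FermionTorus.equivTorusSite.symm.injective
      (show FermionTorus.ofTorusSite (y' + Torus.proj L e') = FermionTorus.ofTorusSite (y + Torus.proj L e)
        from heq)
    refine Finset.mem_image.2 ⟨(e, e'), Finset.mk_mem_product he he', ?_⟩
    simp only
    rw [← hinj]; abel
  calc (overlapSet L y).card ≤ ((S ×ˢ S).image fun p => y + Torus.proj L p.1 - Torus.proj L p.2).card :=
        Finset.card_le_card hsub
    _ ≤ (S ×ˢ S).card := Finset.card_image_le
    _ = S.card * S.card := Finset.card_product _ _
    _ ≤ 5 * 5 := Nat.mul_le_mul (card_steps_le) (card_steps_le)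

/-! ### The Hubbard terms anchored at a site -/

/-- The anchor of a local Hubbard term: the first endpoint of an ordered bond, or the site.
[cite: KomaTasaki1994, §3.3 (2.3)] -/
def termAnchor : HubbardIdx (fermionTorusGraph 2 L) → TorusSite 2 L
  | Sum.inl p => FermionTorus.toTorusSite p.1.1
  | Sum.inr x => FermionTorus.toTorusSite x

omit [NeZero L] in
/-- `Torus.proj L (±eᵢ) = ±eᵢ`. [folklore] -/
private theorem proj_single (i : Fin 2) : Torus.proj L (Pi.single i (1 : ℤ)) = Pi.single i (1 : ZMod L) := by
  funext j
  by_cases h : j = i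
  · subst h; simp
  · simp [h]

omit [NeZero L] in
/-- `Torus.proj L (-v) = -Torus.proj L v`. [folklore] -/
private theorem proj_neg (v : Site 2) : Torus.proj L (-v) = -Torus.proj L v := by
  funext j; simp

/-- `±eᵢ ∈ unitSteps`. [folklore] -/
private theorem single_mem_steps (i : Fin 2) :
    (Pi.single i (1 : ℤ) : Site 2) ∈ insert (0 : Site 2) unitSteps ∧
      (-(Pi.single i (1 : ℤ) : Site 2)) ∈ insert (0 : Site 2) unitSteps := by
  fin_cases i <;> simp [unitSteps]

/-- A neighbour of `x` lies in the plaquette of `x`. [folklore] -/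
private theorem mem_plaq_of_adj {x x' : FermionTorus 2 L} (h : (fermionTorusGraph 2 L).Adj x x') :
    x' ∈ plaq L (FermionTorus.toTorusSite x) := by
  rw [fermionTorusGraph_adj, torusGraph_adj_iff] at h
  obtain ⟨-, ⟨i, hi⟩ | ⟨i, hi⟩⟩ := h
  · have hmem := add_mem_plaq L (FermionTorus.toTorusSite x) (single_mem_steps i).1
    rw [proj_single, ← hi, FermionTorus.ofTorusSite_toTorusSite] at hmem
    exact hmem
  · have hmem := add_mem_plaq L (FermionTorus.toTorusSite x) (single_mem_steps i).2
    rw [proj_neg, proj_single] at hmem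
    have hx' : FermionTorus.toTorusSite x + -Pi.single i (1 : ZMod L) = FermionTorus.toTorusSite x' := by
      rw [hi]; abel
    rw [hx', FermionTorus.ofTorusSite_toTorusSite] at hmem
    exact hmem

/-- Every Hubbard term is supported in the plaquette of its anchor. [cite: KomaTasaki1994, §2.3 ii)] -/
theorem hubbardTermSupp_subset_plaq (Z : HubbardIdx (fermionTorusGraph 2 L)) :
    hubbardTermSupp (fermionTorusGraph 2 L) Z ⊆ plaq L (termAnchor L Z) := by
  rcases Z with p | x
  · intro z hz
    simp only [hubbardTermSupp, Finset.mem_insert, Finset.mem_singleton] at hz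
    rcases hz with rfl | rfl
    · have h := self_mem_plaq L (FermionTorus.toTorusSite p.1.1)
      rw [FermionTorus.ofTorusSite_toTorusSite] at h
      exact h
    · exact mem_plaq_of_adj L p.2
  · intro z hz
    simp only [hubbardTermSupp, Finset.mem_singleton] at hz
    rw [hz]
    have h := self_mem_plaq L (FermionTorus.toTorusSite x)
    rw [FermionTorus.ofTorusSite_toTorusSite] at h
    exact h

variable (t U μ : ℝ)

/-- **The local Hamiltonian `h_y`**: the sum of the Hubbard terms anchored at `y` (hoppings on the
ordered bonds out of `y`, and `U n_{y↑}n_{y↓} - μ n_y`). [cite: KomaTasaki1994, §3.3 (2.3)] -/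
def localHam (y : TorusSite 2 L) :
    Matrix (Finset (Orb (FermionTorus 2 L))) (Finset (Orb (FermionTorus 2 L))) ℂ :=
  ∑ Z ∈ Finset.univ.filter (fun Z => termAnchor L Z = y), hubbardTermOp (fermionTorusGraph 2 L) t U μ Z

/-- `Σ_y h_y = H(t,U) - μN` on the torus. [cite: KomaTasaki1994, (2.3)] -/
theorem sum_localHam : ∑ y, localHam L t U μ y = hubbardTorusWith 2 L t U μ := by
  rw [hubbardTorusWith, ← sum_hubbardTermOp]
  exact Finset.sum_fiberwise Finset.univ (termAnchor L) _

omit [NeZero L] in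
/-- `h_y` is Hermitian. [cite: KomaTasaki1994, §2.1] -/
theorem isHermitian_localHam (y : TorusSite 2 L) : (localHam L t U μ y).IsHermitian :=
  isHermitian_finset_sum _ fun Z _ => isHermitian_hubbardTermOp _ t U μ Z

/-- `h_y` is an even operator localised on `plaq y`. [cite: KomaTasaki1994, §2.3 ii)] -/
theorem localHam_mem (y : TorusSite 2 L) :
    localHam L t U μ y ∈ carEvenSubalgebra (orbSet (plaq L y)) := by
  refine Subalgebra.sum_mem _ fun Z hZ => ?_
  rw [Finset.mem_filter] at hZ
  have h := hubbardTermSupp_subset_plaq L Z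
  rw [hZ.2] at h
  exact carEvenSubalgebra_mono (orbSet_mono h) (hubbardTermOp_mem_carEvenSubalgebra _ t U μ Z)

/-- `‖h_y‖ ≤ 45 (2|t| + |U| + 2|μ|)`: at most `|plaq y|·(2·4+1) ≤ 45` terms meet the plaquette of
`y`, each of norm `≤ 2|t| + |U| + 2|μ|`. [cite: KomaTasaki1994, §2.3 iii)] -/
theorem norm_localHam_le (y : TorusSite 2 L) :
    ‖localHam L t U μ y‖ ≤ 45 * (2 * |t| + |U| + 2 * |μ|) := by
  classical
  have hsub : Finset.univ.filter (fun Z => termAnchor L Z = y) ⊆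
      Finset.univ.filter fun Z : HubbardIdx (fermionTorusGraph 2 L) =>
        ¬ Disjoint (hubbardTermSupp (fermionTorusGraph 2 L) Z) (plaq L y) := by
    intro Z hZ
    rw [Finset.mem_filter] at hZ ⊢
    refine ⟨Finset.mem_univ _, ?_⟩
    have hne := hubbardTermSupp_nonempty (fermionTorusGraph 2 L) Z
    obtain ⟨z, hz⟩ := hne
    have hsub := hubbardTermSupp_subset_plaq L Z
    rw [hZ.2] at hsub
    exact fun hd => Finset.disjoint_left.mp hd hz (hsub hz)
  have hcard : (Finset.univ.filter (fun Z => termAnchor L Z = y)).card ≤ 45 := by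
    refine (Finset.card_le_card hsub).trans ?_
    refine (card_filter_not_disjoint_hubbardTermSupp_le (fermionTorusGraph 2 L)
      (card_filter_fermionTorusGraph_adj_le (d := 2) (L := L)) (plaq L y)).trans ?_
    have := card_plaq_le L y
    calc (plaq L y).card * (2 * (2 * 2) + 1) ≤ 5 * (2 * (2 * 2) + 1) := Nat.mul_le_mul_right _ this
      _ = 45 := by norm_num
  have hc0 : 0 ≤ 2 * |t| + |U| + 2 * |μ| := by positivity
  calc ‖localHam L t U μ y‖
      ≤ ∑ Z ∈ Finset.univ.filter (fun Z => termAnchor L Z = y),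
          ‖hubbardTermOp (fermionTorusGraph 2 L) t U μ Z‖ := norm_sum_le _ _
    _ ≤ ∑ _Z ∈ Finset.univ.filter (fun Z => termAnchor L Z = y), (2 * |t| + |U| + 2 * |μ|) :=
        Finset.sum_le_sum fun Z _ => norm_hubbardTermOp_le _ t U μ Z
    _ = (Finset.univ.filter (fun Z => termAnchor L Z = y)).card * (2 * |t| + |U| + 2 * |μ|) := by
        rw [Finset.sum_const, nsmul_eq_mul]
    _ ≤ 45 * (2 * |t| + |U| + 2 * |μ|) := by
        have : ((Finset.univ.filter (fun Z => termAnchor L Z = y)).card : ℝ) ≤ 45 := by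
          exact_mod_cast hcard
        exact mul_le_mul_of_nonneg_right this hc0

/-! ### The order densities `o^{(1)}_y = P_y + P_y†`, `o^{(2)}_y = i(P_y - P_y†)` -/

variable (g : Site 2 → ℝ)

/-- The constant `K_g = 2 Σ_e |g e/√2|` bounding `‖P_y‖`. [folklore] -/
def pairNormConst : ℝ := 2 * ∑ e ∈ insert (0 : Site 2) unitSteps, |g e / Real.sqrt 2|

/-- `K_g ≥ 0`. [folklore] -/
private theorem pairNormConst_nonneg : 0 ≤ pairNormConst g := by
  unfold pairNormConst; positivity

/-- `K_d = 2·4/√2 > 0` for the `d`-wave form factor (indeed for any `g` not vanishing on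
`{0, ±e₁, ±e₂}`). [cite: Scalapino1995, §2 eq. (2.3)] -/
theorem pairNormConst_dWave_pos : 0 < pairNormConst dWaveFormFactor := by
  unfold pairNormConst
  have hmem : (Pi.single 0 1 : Site 2) ∈ insert (0 : Site 2) unitSteps := by simp [unitSteps]
  have hval : dWaveFormFactor (Pi.single 0 1) = 1 := by simp [dWaveFormFactor]
  have hpos : 0 < |dWaveFormFactor (Pi.single 0 1) / Real.sqrt 2| := by
    rw [hval]; positivity
  have hle := Finset.single_le_sum (f := fun e => |dWaveFormFactor e / Real.sqrt 2|)
    (fun e _ => abs_nonneg _) hmem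
  linarith

/-- **The order densities** `o^{(1)}_y = P_y + P_y†` (`α = 0`) and `o^{(2)}_y = i(P_y - P_y†)` (`α = 1`),
`P_y = localPair g L y`. [cite: KomaTasaki1994, §3.3–3.4 (2.13)] -/
def pairDensity (α : Fin 2) (y : TorusSite 2 L) :
    Matrix (Finset (Orb (FermionTorus 2 L))) (Finset (Orb (FermionTorus 2 L))) ℂ :=
  if α = 0 then localPair g L y + (localPair g L y)ᴴ else I • (localPair g L y - (localPair g L y)ᴴ)

/-- `o^{(1)}_y = P_y + P_y†`. [cite: KomaTasaki1994, §3.3 (2.13)] -/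
theorem pairDensity_zero (y : TorusSite 2 L) :
    pairDensity L g 0 y = localPair g L y + (localPair g L y)ᴴ := if_pos rfl

/-- `o^{(2)}_y = i(P_y - P_y†)`. [cite: KomaTasaki1994, §3.3 (2.13)] -/
theorem pairDensity_one (y : TorusSite 2 L) :
    pairDensity L g 1 y = I • (localPair g L y - (localPair g L y)ᴴ) := if_neg (by decide)

/-- `Σ_y o^{(1)}_y = Δ_g + Δ_g†`. [cite: KomaTasaki1994, (2.13)] -/
theorem sum_pairDensity_zero : ∑ y, pairDensity L g 0 y = pairField g L + (pairField g L)ᴴ := by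
  simp only [pairDensity_zero, Finset.sum_add_distrib, pairField, conjTranspose_sum]

/-- `Σ_y o^{(2)}_y = i(Δ_g - Δ_g†)`. [cite: KomaTasaki1994, (2.13)] -/
theorem sum_pairDensity_one :
    ∑ y, pairDensity L g 1 y = I • (pairField g L - (pairField g L)ᴴ) := by
  simp only [pairDensity_one, ← Finset.smul_sum, Finset.sum_sub_distrib, pairField, conjTranspose_sum]

/-- The order densities are Hermitian. [cite: KomaTasaki1994, §2.3] -/
theorem isHermitian_pairDensity (α : Fin 2) (y : TorusSite 2 L) : (pairDensity L g α y).IsHermitian := by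
  unfold pairDensity
  split_ifs
  · rw [Matrix.IsHermitian, conjTranspose_add, conjTranspose_conjTranspose, add_comm]
  · rw [Matrix.IsHermitian, conjTranspose_smul, conjTranspose_sub, conjTranspose_conjTranspose,
      Complex.star_def, Complex.conj_I, neg_smul, ← smul_neg, neg_sub]

omit [NeZero L] in
/-- `b_{uv}` is even and localised on any site set containing `u, v` (for `orbSet`). [folklore] -/
private theorem bondPair_mem_carEvenSubalgebra_orbSet {W : Finset (FermionTorus 2 L)} {u v : FermionTorus 2 L}
    (hu : u ∈ W) (hv : v ∈ W) : bondPair u v ∈ carEvenSubalgebra (orbSet W) := by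
  unfold bondPair
  exact Subalgebra.sub_mem _
    (Algebra.subset_adjoin ⟨(orb u 0, false), (orb v 1, false), orb_mem_orbSet hu 0, orb_mem_orbSet hv 1, rfl⟩)
    (Algebra.subset_adjoin ⟨(orb u 1, false), (orb v 0, false), orb_mem_orbSet hu 1, orb_mem_orbSet hv 0, rfl⟩)

omit [NeZero L] in
/-- `b_{uv}†` is even and localised on any site set containing `u, v`. [folklore] -/
private theorem bondPair_conjTranspose_mem_carEvenSubalgebra_orbSet {W : Finset (FermionTorus 2 L)}
    {u v : FermionTorus 2 L} (hu : u ∈ W) (hv : v ∈ W) :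
    (bondPair u v)ᴴ ∈ carEvenSubalgebra (orbSet W) := by
  rw [bondPair_conjTranspose]
  exact Subalgebra.sub_mem _
    (Algebra.subset_adjoin ⟨(orb v 1, true), (orb u 0, true), orb_mem_orbSet hv 1, orb_mem_orbSet hu 0, rfl⟩)
    (Algebra.subset_adjoin ⟨(orb v 0, true), (orb u 1, true), orb_mem_orbSet hv 0, orb_mem_orbSet hu 1, rfl⟩)

/-- `P_y` is even and localised on `plaq y`. [cite: KomaTasaki1994, §3.4] -/
theorem localPair_mem (y : TorusSite 2 L) : localPair g L y ∈ carEvenSubalgebra (orbSet (plaq L y)) := by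
  rw [localPair_eq_sum_bondPair]
  refine Subalgebra.sum_mem _ fun e he => Subalgebra.smul_mem _ ?_ _
  exact bondPair_mem_carEvenSubalgebra_orbSet L (self_mem_plaq L y) (add_mem_plaq L y he)

/-- `P_y†` is even and localised on `plaq y`. [cite: KomaTasaki1994, §3.4] -/
theorem localPair_conjTranspose_mem (y : TorusSite 2 L) :
    (localPair g L y)ᴴ ∈ carEvenSubalgebra (orbSet (plaq L y)) := by
  rw [localPair_eq_sum_bondPair, conjTranspose_sum]
  refine Subalgebra.sum_mem _ fun e he => ?_
  rw [conjTranspose_smul]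
  exact Subalgebra.smul_mem _
    (bondPair_conjTranspose_mem_carEvenSubalgebra_orbSet L (self_mem_plaq L y) (add_mem_plaq L y he)) _

/-- The order densities are even operators localised on `plaq y`. [cite: KomaTasaki1994, §2.3 i), §3.4] -/
theorem pairDensity_mem (α : Fin 2) (y : TorusSite 2 L) :
    pairDensity L g α y ∈ carEvenSubalgebra (orbSet (plaq L y)) := by
  unfold pairDensity
  split_ifs
  · exact Subalgebra.add_mem _ (localPair_mem L g y) (localPair_conjTranspose_mem L g y)
  · exact Subalgebra.smul_mem _
      (Subalgebra.sub_mem _ (localPair_mem L g y) (localPair_conjTranspose_mem L g y)) _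

/-- `‖o^{(α)}_y‖ ≤ 2 K_g`. [cite: KomaTasaki1994, §2.3 iii)] -/
theorem norm_pairDensity_le (α : Fin 2) (y : TorusSite 2 L) :
    ‖pairDensity L g α y‖ ≤ 2 * pairNormConst g := by
  have hP : ‖localPair g L y‖ ≤ pairNormConst g := norm_localPair_le g L y
  have hPt : ‖(localPair g L y)ᴴ‖ ≤ pairNormConst g := by rw [l2_opNorm_conjTranspose]; exact hP
  unfold pairDensity
  split_ifs
  · calc _ ≤ ‖localPair g L y‖ + ‖(localPair g L y)ᴴ‖ := norm_add_le _ _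
      _ ≤ pairNormConst g + pairNormConst g := add_le_add hP hPt
      _ = 2 * pairNormConst g := by ring
  · rw [norm_smul, Complex.norm_I, one_mul]
    calc _ ≤ ‖localPair g L y‖ + ‖(localPair g L y)ᴴ‖ := norm_sub_le _ _
      _ ≤ pairNormConst g + pairNormConst g := add_le_add hP hPt
      _ = 2 * pairNormConst g := by ring

/-! ### The charge relations (2.14) with `C = N/2` -/

/-- `Δ_g N = N Δ_g + 2Δ_g` (`[N, P_y] = -2P_y` summed over `y`). [cite: KomaTasaki1994, (2.16), §3.3] -/
theorem pairField_mul_totalNumber :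
    pairField g L * totalNumber = totalNumber * pairField g L + (2 : ℂ) • pairField g L := by
  have h : totalNumber * pairField g L - pairField g L * totalNumber = (-2 : ℂ) • pairField g L := by
    rw [pairField, Finset.mul_sum, Finset.sum_mul, ← Finset.sum_sub_distrib, Finset.smul_sum]
    exact Finset.sum_congr rfl fun y _ => totalNumber_commutator_localPair g L y
  have h' : pairField g L * totalNumber = totalNumber * pairField g L - (-2 : ℂ) • pairField g L := by
    rw [← h]; abel
  rw [h', neg_smul, sub_neg_eq_add]

/-- `Δ_g† N = N Δ_g† - 2Δ_g†`. [cite: KomaTasaki1994, (2.16), §3.3] -/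
theorem pairField_conjTranspose_mul_totalNumber :
    (pairField g L)ᴴ * totalNumber = totalNumber * (pairField g L)ᴴ - (2 : ℂ) • (pairField g L)ᴴ := by
  have hN : (totalNumber : Matrix (Finset (Orb (FermionTorus 2 L))) (Finset (Orb (FermionTorus 2 L))) ℂ)ᴴ
      = totalNumber := totalNumber_isHermitian.eq
  have h := congrArg conjTranspose (pairField_mul_totalNumber L g)
  rw [conjTranspose_mul, conjTranspose_add, conjTranspose_mul, conjTranspose_smul, hN] at h
  -- `h : N Δ† = Δ† N + star 2 • Δ†`
  have h2 : (star (2 : ℂ)) = 2 := by simp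
  rw [h2] at h
  rw [h]; abel

/-- **(2.14), first relation, in matrices**: `[Δ+Δ†, N/2] = -(i · i(Δ - Δ†)) = Δ - Δ†`.
[cite: KomaTasaki1994, (2.14), §3.3] -/
theorem order_zero_comm_halfNumber :
    (pairField g L + (pairField g L)ᴴ) * ((2 : ℂ)⁻¹ • totalNumber) -
        ((2 : ℂ)⁻¹ • totalNumber) * (pairField g L + (pairField g L)ᴴ) =
      -(I • (I • (pairField g L - (pairField g L)ᴴ))) := by
  rw [smul_smul, Complex.I_mul_I, Matrix.mul_smul, Matrix.smul_mul, add_mul, mul_add,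
    pairField_mul_totalNumber, pairField_conjTranspose_mul_totalNumber]
  module

/-- **(2.14), second relation, in matrices**: `[i(Δ-Δ†), N/2] = i(Δ + Δ†)`.
[cite: KomaTasaki1994, (2.14), §3.3] -/
theorem order_one_comm_halfNumber :
    (I • (pairField g L - (pairField g L)ᴴ)) * ((2 : ℂ)⁻¹ • totalNumber) -
        ((2 : ℂ)⁻¹ • totalNumber) * (I • (pairField g L - (pairField g L)ᴴ)) =
      I • (pairField g L + (pairField g L)ᴴ) := by
  rw [Matrix.mul_smul, Matrix.smul_mul, Matrix.smul_mul, Matrix.mul_smul, sub_mul, mul_sub,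
    pairField_mul_totalNumber, pairField_conjTranspose_mul_totalNumber]
  module

/-! ### Transport to `EuclideanSpace` -/

/-- The Fock-space index type. [folklore] -/
abbrev FockIdx (L : ℕ) : Type := Finset (Orb (FermionTorus 2 L))

/-- A Hermitian matrix acts as a symmetric operator on `EuclideanSpace ℂ n`. [folklore] -/
private theorem isSymmetric_toEuclideanCLM {n : Type*} [Fintype n] [DecidableEq n] {A : Matrix n n ℂ}
    (hA : A.IsHermitian) :
    ((toEuclideanCLM (n := n) (𝕜 := ℂ) A : EuclideanSpace ℂ n →L[ℂ] EuclideanSpace ℂ n) :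
      EuclideanSpace ℂ n →ₗ[ℂ] EuclideanSpace ℂ n).IsSymmetric :=
  ContinuousLinearMap.isSelfAdjoint_iff_isSymmetric.mp ((Matrix.isSelfAdjoint_toEuclideanCLM_iff A).mpr hA)

/-- Commuting matrices give commuting operators. [folklore] -/
private theorem commute_toEuclideanCLM {n : Type*} [Fintype n] [DecidableEq n] {A B : Matrix n n ℂ}
    (h : Commute A B) :
    Commute (toEuclideanCLM (n := n) (𝕜 := ℂ) A) (toEuclideanCLM (n := n) (𝕜 := ℂ) B) := by
  have := congrArg (toEuclideanCLM (n := n) (𝕜 := ℂ)) h.eq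
  rw [map_mul, map_mul] at this
  exact this

end DWaveKT

open DWaveKT

/-! ### The instance -/

section Instance

variable (L : ℕ) [NeZero L] (t U μ : ℝ) (g : Site 2 → ℝ)

/-- **The grand-canonical Hubbard torus with the pair field `Δ_g` as a bounded-overlap Koma–Tasaki
`U(1)` system** (KT94 §3.3–3.4 data): lattice `Λ = (ℤ/Lℤ)²`, Hilbert space the fermionic Fock space
(as `EuclideanSpace`), `h_y = localHam y`, `o^{(1)}_y = P_y + P_y†`, `o^{(2)}_y = i(P_y - P_y†)`,
`C = N/2`, `S_y = T_y = overlapSet y` (`r = r′ = 25`), `h̄ = 45(2|t|+|U|+2|μ|)`, `o = 2K_g`.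
[cite: KomaTasaki1994, §3.3–3.4, §2.3 (2.12)–(2.17)] [cite: KomaTasaki1993, §7 (before Theorem 7.3)] -/
def dWaveKTSystem (hg : 0 < pairNormConst g) :
    KomaTasaki.U1OverlapSystem (TorusSite 2 L) (EuclideanSpace ℂ (FockIdx L)) where
  h y := toEuclideanCLM (n := FockIdx L) (𝕜 := ℂ) (localHam L t U μ y)
  o α y := toEuclideanCLM (n := FockIdx L) (𝕜 := ℂ) (pairDensity L g α y)
  C := toEuclideanCLM (n := FockIdx L) (𝕜 := ℂ) ((2 : ℂ)⁻¹ • totalNumber)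
  supp := overlapSet L
  r := 25
  osupp := overlapSet L
  r' := 25
  hbar := 45 * (2 * |t| + |U| + 2 * |μ|)
  obar := 2 * pairNormConst g
  isSymmetric_h y := isSymmetric_toEuclideanCLM (isHermitian_localHam L t U μ y)
  isSymmetric_o α y := isSymmetric_toEuclideanCLM (isHermitian_pairDensity L g α y)
  isSymmetric_C := isSymmetric_toEuclideanCLM
    (IsHermitian.smul totalNumber_isHermitian (by rw [IsSelfAdjoint]; simp))
  commute_hamiltonian_C := by
    rw [← map_sum, sum_localHam]
    exact commute_toEuclideanCLM
      (((hamiltonianWith_commute_totalNumber (fermionTorusGraph 2 L) t U μ)).smul_right _)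
  order_zero_C := by
    rw [← map_sum, ← map_sum, sum_pairDensity_zero, sum_pairDensity_one, ← map_mul, ← map_mul,
      ← map_sub, order_zero_comm_halfNumber, map_neg, map_smul]
  order_one_C := by
    rw [← map_sum, ← map_sum, sum_pairDensity_zero, sum_pairDensity_one, ← map_mul, ← map_mul,
      ← map_sub, order_one_comm_halfNumber, map_smul]
  commute_o x y hy α β :=
    commute_toEuclideanCLM (commute_of_mem_carEvenSubalgebra (pairDensity_mem L g α x)
      ((carEvenSubalgebra_le_carSubalgebra _) (pairDensity_mem L g β y))
      (disjoint_orbSet (disjoint_plaq_of_not_mem L hy)))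
  card_osupp_le := card_overlapSet_le L
  commute_h_o x y hy α :=
    commute_toEuclideanCLM (commute_of_mem_carEvenSubalgebra (localHam_mem L t U μ x)
      ((carEvenSubalgebra_le_carSubalgebra _) (pairDensity_mem L g α y))
      (disjoint_orbSet (disjoint_plaq_of_not_mem L hy)))
  card_supp_le := card_overlapSet_le L
  two_le_r := by norm_num
  norm_h_le y := by rw [Matrix.l2_opNorm_toEuclideanCLM]; exact norm_localHam_le L t U μ y
  norm_o_le α y := by rw [Matrix.l2_opNorm_toEuclideanCLM]; exact norm_pairDensity_le L g α y
  obar_pos := by positivity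

end Instance

/-! ### Dictionary: the instance's operators in matrix terms, hypothesis iv), ground states -/

section Dictionary

variable {L : ℕ} [NeZero L] (t U μ : ℝ) (g : Site 2 → ℝ) (hg : 0 < pairNormConst g)

omit [NeZero L] in
/-- `⟨toLp x, toLp y⟩ = x† y`. [folklore] -/
private theorem inner_toLp_toLp_eq (x y : FockIdx L → ℂ) :
    ⟪(toLp 2 x : EuclideanSpace ℂ (FockIdx L)), toLp 2 y⟫_ℂ = star x ⬝ᵥ y := by
  rw [EuclideanSpace.inner_toLp_toLp, dotProduct_comm]

omit [NeZero L] in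
/-- `‖toLp v‖² = Re v†v`. [folklore] -/
private theorem norm_toLp_sq_eq (v : FockIdx L → ℂ) :
    ‖(toLp 2 v : EuclideanSpace ℂ (FockIdx L))‖ ^ 2 = (star v ⬝ᵥ v).re := by
  rw [← inner_toLp_toLp_eq, ← inner_self_eq_norm_sq (𝕜 := ℂ)]
  rfl

/-- `H_sys = toEuclideanCLM (H(t,U) - μN)`. [cite: KomaTasaki1994, (2.3), §3.3] -/
theorem dWaveKTSystem_hamiltonian :
    (dWaveKTSystem L t U μ g hg).hamiltonian =
      toEuclideanCLM (n := FockIdx L) (𝕜 := ℂ) (hubbardTorusWith 2 L t U μ) := by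
  change ∑ y, toEuclideanCLM (n := FockIdx L) (𝕜 := ℂ) (localHam L t U μ y) = _
  rw [← map_sum, sum_localHam]

/-- `O^{(1)}_sys = toEuclideanCLM (Δ_g + Δ_g†)`. [cite: KomaTasaki1994, (2.13), §3.3] -/
theorem dWaveKTSystem_order_zero :
    (dWaveKTSystem L t U μ g hg).order 0 =
      toEuclideanCLM (n := FockIdx L) (𝕜 := ℂ) (pairField g L + (pairField g L)ᴴ) := by
  change ∑ y, toEuclideanCLM (n := FockIdx L) (𝕜 := ℂ) (pairDensity L g 0 y) = _
  rw [← map_sum, sum_pairDensity_zero]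

/-- `O^{(2)}_sys = toEuclideanCLM (i(Δ_g - Δ_g†))`. [cite: KomaTasaki1994, (2.13), §3.3] -/
theorem dWaveKTSystem_order_one :
    (dWaveKTSystem L t U μ g hg).order 1 =
      toEuclideanCLM (n := FockIdx L) (𝕜 := ℂ) (I • (pairField g L - (pairField g L)ᴴ)) := by
  change ∑ y, toEuclideanCLM (n := FockIdx L) (𝕜 := ℂ) (pairDensity L g 1 y) = _
  rw [← map_sum, sum_pairDensity_one]

/-- `C_sys = toEuclideanCLM (N/2)`. [cite: KomaTasaki1994, (2.12), §3.3] -/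
theorem dWaveKTSystem_C :
    (dWaveKTSystem L t U μ g hg).C = toEuclideanCLM (n := FockIdx L) (𝕜 := ℂ) ((2 : ℂ)⁻¹ • totalNumber) :=
  rfl

/-- `o = 2K_g`. [cite: KomaTasaki1994, §2.3 iii)] -/
theorem dWaveKTSystem_obar : (dWaveKTSystem L t U μ g hg).obar = 2 * pairNormConst g := rfl

/-- `h̄ = 45(2|t| + |U| + 2|μ|)`. [cite: KomaTasaki1994, §2.3 iii)] -/
theorem dWaveKTSystem_hbar :
    (dWaveKTSystem L t U μ g hg).hbar = 45 * (2 * |t| + |U| + 2 * |μ|) := rfl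

/-- `r = 25`. [cite: KomaTasaki1994, §2.3 ii)] -/
theorem dWaveKTSystem_r : (dWaveKTSystem L t U μ g hg).r = 25 := rfl

/-- `r′ = 25`. [cite: KomaTasaki1994, §2.3 i)] -/
theorem dWaveKTSystem_r' : (dWaveKTSystem L t U μ g hg).r' = 25 := rfl

/-- **The sourced Hamiltonian of the instance**: `H_sys - B·O^{(1)}_sys = toEuclideanCLM (H(t,U) - μN -
B(Δ_g + Δ_g†))`; for `t = 1`, `g = dWaveFormFactor` the matrix is `dWaveSourceTorus L U μ B`.
[cite: KomaTasaki1994, §1, (2.6)] -/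
theorem dWaveKTSystem_field (B : ℝ) :
    (dWaveKTSystem L t U μ g hg).hamiltonian - (B : ℂ) • (dWaveKTSystem L t U μ g hg).order 0 =
      toEuclideanCLM (n := FockIdx L) (𝕜 := ℂ)
        (hubbardTorusWith 2 L t U μ - (B : ℂ) • (pairField g L + (pairField g L)ᴴ)) := by
  rw [dWaveKTSystem_hamiltonian, dWaveKTSystem_order_zero, map_sub, map_smul]

/-- `dWaveSourceTorus L U μ B = H(1,U) - μN - B(Δ_d + Δ_d†)` (unfolding). [cite: KomaTasaki1994, §1] -/
theorem dWaveSourceTorus_eq_sub (B : ℝ) :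
    dWaveSourceTorus L U μ B =
      hubbardTorusWith 2 L 1 U μ -
        (B : ℂ) • (pairField dWaveFormFactor L + (pairField dWaveFormFactor L)ᴴ) :=
  rfl

/-- `|Λ| = L²` for the torus `(ℤ/Lℤ)²`. [folklore] -/
private theorem card_torusSite_sq : Fintype.card (TorusSite 2 L) = L ^ 2 := by
  simp [TorusSite, ZMod.card]

/-- **Hypothesis iv) (2.17) for the `d`-wave instance from matrix data.**  A unit Fock vector `Φ` which is
an eigenvector of `H(t,U) - μN` (eigenvalue `E₀`) and of the particle number (`NΦ = νΦ`; e.g. a ground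
state inside a particle-number sector) and carries pair long-range order
`(μ′ · 2K_g · L²)² ≤ Re Φ†(Δ_g+Δ_g†)²Φ`, `0 < μ′ ≤ 1`, is an `IsLROEigenstate` of `dWaveKTSystem` with
parameter `μ′`; the companion identity `⟨(O^{(1)})²⟩ = ⟨(O^{(2)})²⟩` is automatic
(`KomaTasaki.U1System.inner_order_sq_eq_of_eigen_C`). [cite: KomaTasaki1994, §2.3 iv) (2.17), §3.3] -/
theorem dWaveKTSystem_isLROEigenstate {Φ : FockIdx L → ℂ} {E₀ : ℝ} {ν : ℂ} {μ' : ℝ}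
    (hΦ : star Φ ⬝ᵥ Φ = 1) (hH : hubbardTorusWith 2 L t U μ *ᵥ Φ = (E₀ : ℂ) • Φ)
    (hN : totalNumber *ᵥ Φ = ν • Φ) (hμ : 0 < μ') (hμ1 : μ' ≤ 1)
    (hlro : (μ' * (2 * pairNormConst g) * (L : ℝ) ^ 2) ^ 2 ≤
      (star Φ ⬝ᵥ ((pairField g L + (pairField g L)ᴴ) *ᵥ
        ((pairField g L + (pairField g L)ᴴ) *ᵥ Φ))).re) :
    (dWaveKTSystem L t U μ g hg).IsLROEigenstate (toLp 2 Φ) E₀ μ' := by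
  set sys := dWaveKTSystem L t U μ g hg with hsys
  have hC : sys.C (toLp 2 Φ) = ((2 : ℂ)⁻¹ * ν) • toLp 2 Φ := by
    rw [hsys, dWaveKTSystem_C, toEuclideanCLM_toLp, smul_mulVec, hN, smul_smul, toLp_smul]
  refine sys.isLROEigenstate_of ?_ ?_ ⟨_, hC⟩ hμ hμ1 ?_ ?_
  · -- `‖Φ‖ = 1`
    have h2 : ‖(toLp 2 Φ : EuclideanSpace ℂ (FockIdx L))‖ ^ 2 = 1 := by
      rw [norm_toLp_sq_eq, hΦ, Complex.one_re]
    have h0 : 0 ≤ ‖(toLp 2 Φ : EuclideanSpace ℂ (FockIdx L))‖ := norm_nonneg _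
    nlinarith
  · rw [hsys, dWaveKTSystem_hamiltonian, toEuclideanCLM_toLp, hH, toLp_smul]
  · rw [hsys, dWaveKTSystem_order_zero, toEuclideanCLM_toLp, toEuclideanCLM_toLp, inner_toLp_toLp_eq,
      dWaveKTSystem_obar, card_torusSite_sq, Nat.cast_pow]
    exact hlro
  · have h := KomaTasaki.U1System.inner_order_sq_eq_of_eigen_C sys.collapse
      (show sys.collapse.C (toLp 2 Φ) = ((2 : ℂ)⁻¹ * ν) • toLp 2 Φ from hC)
    rwa [KomaTasaki.U1OverlapSystem.collapse_order, KomaTasaki.U1OverlapSystem.collapse_order] at h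

omit [NeZero L] in
/-- **Ground states in matrix terms, I**: the ground-state energy bounds every unit Rayleigh quotient on
`EuclideanSpace` (the hypothesis `hground` of the Koma–Tasaki field theorems; the variational principle,
Tasaki (2020) §2.1 / tree `Matrix.groundEnergy_le_rayleigh`). [cite: Tasaki2020, §2.1] -/
theorem groundEnergy_le_re_inner_toEuclideanCLM {K : Matrix (FockIdx L) (FockIdx L) ℂ}
    (hK : K.IsHermitian) (ψ : EuclideanSpace ℂ (FockIdx L)) (hψ : ‖ψ‖ = 1) :
    K.groundEnergy ≤ (⟪ψ, toEuclideanCLM (n := FockIdx L) (𝕜 := ℂ) K ψ⟫_ℂ).re := by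
  have hv : star (ofLp ψ) ⬝ᵥ ofLp ψ = 1 := by
    have h := inner_self_eq_norm_sq_to_K (𝕜 := ℂ) ψ
    rw [hψ] at h
    rw [← inner_toLp_toLp_eq, toLp_ofLp, h]
    norm_num
  have h := Matrix.groundEnergy_le_rayleigh_holds hK (ofLp ψ) hv
  have e : (⟪ψ, toEuclideanCLM (n := FockIdx L) (𝕜 := ℂ) K ψ⟫_ℂ) = star (ofLp ψ) ⬝ᵥ (K *ᵥ ofLp ψ) := by
    rw [← inner_toLp_toLp_eq, ← toEuclideanCLM_toLp, toLp_ofLp]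
  rw [e]
  exact h

omit [NeZero L] in
/-- **Ground states in matrix terms, II**: a unit eigenvector of the Hermitian `K` with the ground-state
energy minimises the Rayleigh quotient of `toEuclideanCLM K` (the hypothesis `hmin` of the field
theorems, with `K = H - B·O`; variational principle, Tasaki (2020) §2.1). [cite: Tasaki2020, §2.1] -/
theorem re_inner_le_of_groundState {K : Matrix (FockIdx L) (FockIdx L) ℂ} (hK : K.IsHermitian)
    {Φ : FockIdx L → ℂ} (hΦ : star Φ ⬝ᵥ Φ = 1) (hKΦ : K *ᵥ Φ = ((K.groundEnergy : ℝ) : ℂ) • Φ)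
    (ψ : EuclideanSpace ℂ (FockIdx L)) (hψ : ‖ψ‖ = 1) :
    (⟪(toLp 2 Φ : EuclideanSpace ℂ (FockIdx L)),
        toEuclideanCLM (n := FockIdx L) (𝕜 := ℂ) K (toLp 2 Φ)⟫_ℂ).re ≤
      (⟪ψ, toEuclideanCLM (n := FockIdx L) (𝕜 := ℂ) K ψ⟫_ℂ).re := by
  have h1 : (⟪(toLp 2 Φ : EuclideanSpace ℂ (FockIdx L)),
      toEuclideanCLM (n := FockIdx L) (𝕜 := ℂ) K (toLp 2 Φ)⟫_ℂ).re = K.groundEnergy := by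
    rw [toEuclideanCLM_toLp, hKΦ, toLp_smul, inner_smul_right, inner_toLp_toLp_eq, hΦ, mul_one,
      Complex.ofReal_re]
  rw [h1]
  exact groundEnergy_le_re_inner_toEuclideanCLM hK ψ hψ

end Dictionary

end Literature.MathematicalPhysics.QuantumLattice
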